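import Summits.QuantumFields.QCD.Theorems.QuarksAsStableActionStableActionBridgeTorusDenominator

/-!
# Gluonic expectations of torus lattice QCD as ratios of cyclic kernel supertrace integrals
(crux `QuarksAsStableAction.StableActionBridge`, item stmt-QuantumFields-9737, line `Sketch`;
registered stubs `qcd_boltzmann_integral_mul_eq_cyclic_supertrace` and
`qcdTorusExpect_gaugeObservable_eq_cyclic_ratio`)

Numerators of the STATEMENT's functional for gluonic observables.  For `N_f` flavours of `r = 1`
Wilson quarks of bare masses `m_f > −1` (fundamental representation of `SU(3)`) on the four-torus
`(ℤ/N)⁴` at inverse coupling `β`, with `D(U) = diracMatrix U mq` the flavour-diagonal Wilson–Dirac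
matrix, the statement's expectation `qcdTorusExpect β N mq X` of a GRASSMANN-CONSTANT insertion
`X(U) = Φ(U) · 1` (a continuous function `Φ` of the gauge field alone, e.g. a Wilson loop or the
plaquette energy) is

  `⟨Φ⟩ = ∫ dμ_W ∫dψ̄dψ Φ(U) e^{−ψ̄D(U)ψ} / ∫ dμ_W ∫dψ̄dψ e^{−ψ̄D(U)ψ}
       = ∫ e^{−β S_W(U)} det D(U) Φ(U) ∏ dU_e / ∫ e^{−β S_W(U)} det D(U) ∏ dU_e`

(the Berezin orientation sign `ε = (−1)^{n(n−1)/2+n}` and the pure-gauge partition function `Z_W`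
cancel between numerator and denominator).  Slicing the torus across Euclidean time (spatial links
`Us t`, temporal links `gs t` leaving slice `t`, assembled field `U = asm (Us, gs)`), both Haar
integrals become cyclic transfer-kernel supertrace integrals,

  `∫ e^{−β S_W} det D · Φ ∏ dU_e
     = ∫∫ ∏_t K_β(Us t, (Us (t+1))^{gs t}) · STr ∏_t T̂_F(Us t) Γ(G_{gs t}) · Φ(asm (Us, gs)) dUs dgs`,

with `K_β` the temporal-gauge transfer kernel of the gauge field (`gaugeSliceKernel`, Smit (4.121),
(4.129)), `T̂_F` Smit's `N_f`-flavour fermionic transfer operator (`fermionSliceOp`, Smit (6.91)),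
`Γ(G_g)` the Fock-space gauge rotation (`fockGaugeAct`, Smit (4.125)–(4.127)),
`STr X = Σ_s (−1)^{#s} X_{ss}`, and the observable `Φ` read on the assembled slices.  The Haar
integrals over the temporal links are the Gauss-law projections `P̂₀` (Smit (4.137)), so unquenched
gluonic expectations are ratios `STr[(𝕋P̂₀)^N Φ] / STr[(𝕋P̂₀)^N]` at kernel level (Lüscher 1977;
Osterwalder–Seiler 1978 §§2–3).

Contents (pure theorem file, no definitions):
* `qcd_boltzmann_integral_mul_eq_cyclic_supertrace` — the master sliced identity with a continuous
  gluonic weight `Φ` (the `Φ = 1` case is the `N_f`-flavour capstone C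
  `qcd_boltzmann_integral_eq_cyclic_supertrace_flavour`): transport along the measure-preserving
  assembling map (`stub_timeSlicing`, `integral_map`) of the pointwise identity
  `CyclicSupertraceFlavour.integrand_timeAssemble`, the factor `Φ(asm p)` carried along;
* `qcdTorusExpect_gaugeObservable_eq_cyclic_ratio` — `qcdTorusExpect` of the insertion
  `U ↦ Φ(U) · 1`: `∫dψ̄dψ (Φ · 1) e^{−ψ̄Dψ} = Φ · ε det D` (`fermiIntegral_fermiBoltzmann`, linearity
  of the Berezin integral), Wilson-measure integrals as Haar quotients
  (`TorusDenominator.integral_wilsonMeasure_eq_div`), cancellation of `ε / Z_W` (`Z_W > 0`), and the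
  two sliced identities.

References: M. Lüscher, Commun. Math. Phys. 54 (1977) 283 [Luscher1977, pp. 283–292];
K. Osterwalder, E. Seiler, Ann. Phys. 110 (1978) 440 [OsterwalderSeiler1978, §§2–3]; J. Smit,
*Introduction to Quantum Fields on a Lattice* [Smit2023, §4.6 (4.127)–(4.137), §6.5 (6.87)–(6.91)];
I. Montvay and G. Münster, *Quantum Fields on a Lattice* [MontvayMunster1994, §5.1.2].
-/

noncomputable section

namespace Summit.QuantumFields.QCD.Cruxes.StableActionBridge.Sketch

open MeasureTheory Matrix Literature.MathematicalPhysics.QuantumFieldTheory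
  Literature.MathematicalPhysics.QuantumLattice
open Literature.Probability.LatticeModels (TorusSite)

namespace GluonicExpectation

/-- **Pointwise identity behind the master sliced identity.**  At the field assembled from
`p = (Us, gs)` the weighted `N_f`-flavour QCD Boltzmann integrand `e^{−β S_W(U)} det D(U) Φ(U)` is
the cyclic kernel product times the supertrace of the time-ordered product of projected fermionic
transfer operators, times the gluonic weight `Φ` read on the assembled slices.
[cite: Luscher1977, pp. 283–292] [cite: Smit2023, §4.6 (4.127)–(4.137), §6.5 (6.87)–(6.91)]
[cite: MontvayMunster1994, §5.1.2] -/
theorem integrand_mul_timeAssemble (Nf N : ℕ) [NeZero N] (β : ℝ) (mq : Fin Nf → ℝ)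
    (hm : ∀ f, -1 < mq f) (Φ : GaugeConfig 4 N (Matrix.specialUnitaryGroup (Fin 3) ℂ) → ℂ)
    (p : (ZMod N → GaugeConfig 3 N (Matrix.specialUnitaryGroup (Fin 3) ℂ)) ×
      (ZMod N → TorusSite 3 N → Matrix.specialUnitaryGroup (Fin 3) ℂ)) :
    (Real.exp (-(β * wilsonAction (fundamentalRep (Fin 3))
        (fun e : Edge 4 N =>
          (Fin.cons (p.2 (e.1 0) (Fin.tail e.1)) (fun i : Fin 3 => p.1 (e.1 0) (Fin.tail e.1, i)) :
            Fin 4 → Matrix.specialUnitaryGroup (Fin 3) ℂ) e.2))) : ℂ) *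
        (diracMatrix
          (fun e : Edge 4 N =>
            (Fin.cons (p.2 (e.1 0) (Fin.tail e.1)) (fun i : Fin 3 => p.1 (e.1 0) (Fin.tail e.1, i)) :
              Fin 4 → Matrix.specialUnitaryGroup (Fin 3) ℂ) e.2) mq).det *
        Φ (fun e : Edge 4 N =>
          (Fin.cons (p.2 (e.1 0) (Fin.tail e.1)) (fun i : Fin 3 => p.1 (e.1 0) (Fin.tail e.1, i)) :
            Fin 4 → Matrix.specialUnitaryGroup (Fin 3) ℂ) e.2) =
      ((∏ t : ZMod N, gaugeSliceKernel β (p.1 t) (gaugeTransform (p.2 t) (p.1 (t + 1))) : ℝ) : ℂ) *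
        (∑ s : Finset (SliceFermiIdx Nf N), (-1 : ℂ) ^ s.card *
          (((List.range N).map fun i : ℕ =>
              fermionSliceOp (p.1 (i : ZMod N)) mq *
                fockGaugeAct (Nf := Nf) (p.2 (i : ZMod N))).prod) s s) *
        Φ (fun e : Edge 4 N =>
          (Fin.cons (p.2 (e.1 0) (Fin.tail e.1)) (fun i : Fin 3 => p.1 (e.1 0) (Fin.tail e.1, i)) :
            Fin 4 → Matrix.specialUnitaryGroup (Fin 3) ℂ) e.2) := by
  rw [CyclicSupertraceFlavour.integrand_timeAssemble Nf N β mq hm p]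

/-- The weighted `N_f`-flavour QCD Boltzmann integrand `U ↦ e^{−β S_W(U)} det D(U) Φ(U)` is
continuous on the compact configuration space `SU(3)^{edges}` for a continuous gluonic weight `Φ`.
[folklore] -/
theorem continuous_integrand_mul (Nf N : ℕ) [NeZero N] (β : ℝ) (mq : Fin Nf → ℝ)
    {Φ : GaugeConfig 4 N (Matrix.specialUnitaryGroup (Fin 3) ℂ) → ℂ} (hΦ : Continuous Φ) :
    Continuous fun U : GaugeConfig 4 N (Matrix.specialUnitaryGroup (Fin 3) ℂ) =>
      (Real.exp (-(β * wilsonAction (fundamentalRep (Fin 3)) U)) : ℂ) * (diracMatrix U mq).det *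
        Φ U :=
  (CyclicSupertraceFlavour.continuous_integrand Nf N β mq).mul hΦ

/-- Pulling a constant out of a weighted integral and reordering the factors:
`∫ w · (Φ · (c · d)) = c · ∫ w · d · Φ`. [folklore] -/
theorem integral_weight_mul_mul_const_mul {α : Type*} [MeasurableSpace α] (μ : Measure α)
    (c : ℂ) (w d Φ : α → ℂ) :
    ∫ x, w x * (Φ x * (c * d x)) ∂μ = c * ∫ x, w x * d x * Φ x ∂μ := by
  rw [← integral_const_mul]
  refine integral_congr_ae (ae_of_all _ fun x => ?_)
  ring

/-- Pulling a constant out of a weighted integral: `∫ w · (c · d) = c · ∫ w · d`. [folklore] -/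
theorem integral_weight_mul_const_mul {α : Type*} [MeasurableSpace α] (μ : Measure α) (c : ℂ)
    (w d : α → ℂ) : ∫ x, w x * (c * d x) ∂μ = c * ∫ x, w x * d x ∂μ := by
  rw [← integral_const_mul]
  refine integral_congr_ae (ae_of_all _ fun x => ?_)
  ring

/-- **The pure-gauge partition function of the torus is a nonzero complex number**: the real Haar
integral `Z_W = ∫ e^{−β S_W(U)} ∏_e dU_e` of the positive continuous Boltzmann weight is positive
(read off from `partitionFunction ≠ 0` for the continuous fundamental representation). [folklore] -/
theorem ofReal_integral_exp_wilsonAction_ne_zero (N : ℕ) [NeZero N] (β : ℝ) :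
    ((∫ U : GaugeConfig 4 N (Matrix.specialUnitaryGroup (Fin 3) ℂ),
        Real.exp (-(β * wilsonAction (fundamentalRep (Fin 3)) U))
        ∂(Measure.pi fun _ : Edge 4 N => haarProbability (Matrix.specialUnitaryGroup (Fin 3) ℂ)) :
          ℝ) : ℂ) ≠ 0 := by
  obtain ⟨hZ0, -⟩ := partitionFunction_fundamental_ne_zero_and_ne_top (S := N) β
  rw [TorusDenominator.partitionFunction_eq_ofReal_integral (continuous_fundamentalRep (Fin 3)) β,
    ne_eq, ENNReal.ofReal_eq_zero, not_le] at hZ0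
  exact Complex.ofReal_ne_zero.2 hZ0.ne'

/-- **Berezin integral of a Grassmann-constant insertion.**  For a scalar `c`,
`∫dψ̄dψ (c · 1) e^{−ψ̄D(U)ψ} = c · ε det D(U)` with `ε = (−1)^{n(n−1)/2+n}` the orientation sign of
the tree's Berezin integral (`n` = number of quark variables): linearity of the Berezin integral
and the Gaussian formula `∫dψ̄dψ e^{−ψ̄Dψ} = ε det D`. [cite: MontvayMunster1994, §4.1 (4.17)] -/
theorem fermiIntegral_algebraMap_mul_fermiBoltzmann {Nf N : ℕ} [NeZero N]
    (U : GaugeConfig 4 N (Matrix.specialUnitaryGroup (Fin 3) ℂ)) (mq : Fin Nf → ℝ) (c : ℂ) :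
    fermiIntegral (algebraMap ℂ (FermiAlg Nf N) c * fermiBoltzmann U mq) =
      c * ((-1 : ℂ) ^ (Fintype.card (FermiIdx Nf N) * (Fintype.card (FermiIdx Nf N) - 1) / 2 +
          Fintype.card (FermiIdx Nf N)) * (diracMatrix U mq).det) := by
  rw [← Algebra.smul_def, map_smul, smul_eq_mul, fermiIntegral_fermiBoltzmann]

end GluonicExpectation

/-- **Master sliced identity with a gluonic weight (stub
`qcd_boltzmann_integral_mul_eq_cyclic_supertrace` of line `Sketch`).**  For `N_f` flavours of
`r = 1` Wilson quarks of bare masses `m_f > −1` (fundamental representation of `SU(3)`) on the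
four-torus `(ℤ/N)⁴`, `D(U) = diracMatrix U mq` the flavour-diagonal Wilson–Dirac matrix, and every
CONTINUOUS function `Φ` of the gauge field,
`∫ e^{−β S_W(U)} det D(U) Φ(U) dU = ∫∫ ∏_t K_β(Us t, (Us (t+1))^{gs t}) · STr ∏_t T̂_F(Us t) Γ(G_{gs t}) · Φ(asm (Us, gs)) dUs dgs`,
where `asm (Us, gs)` is the four-torus field assembled from the spatial slices `Us t` and the
temporal links `gs t` (Yang–Mills time slicing, measure preserving): Lüscher's transfer-matrix
representation of unquenched gluonic numerators at kernel level, without gauge fixing — the Haar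
integrals over the temporal links are the Gauss-law projections `P̂₀`.
[cite: Luscher1977, pp. 283–292] [cite: OsterwalderSeiler1978, §§2–3]
[cite: Smit2023, §4.6 (4.127)–(4.137), §6.5 (6.87)–(6.91)] [cite: MontvayMunster1994, §5.1.2] -/
theorem qcd_boltzmann_integral_mul_eq_cyclic_supertrace : ∀ (Nf N : ℕ) [NeZero N] (β : ℝ) (mq : Fin Nf → ℝ), (∀ f, -1 < mq f) → ∀ (Φ : GaugeConfig 4 N (Matrix.specialUnitaryGroup (Fin 3) ℂ) → ℂ), Continuous Φ → ∫ U : GaugeConfig 4 N (Matrix.specialUnitaryGroup (Fin 3) ℂ), (Real.exp (-(β * wilsonAction (fundamentalRep (Fin 3)) U)) : ℂ) * (diracMatrix U mq).det * Φ U ∂(Measure.pi fun _ : Edge 4 N => haarProbability (Matrix.specialUnitaryGroup (Fin 3) ℂ)) = ∫ p : (ZMod N → GaugeConfig 3 N (Matrix.specialUnitaryGroup (Fin 3) ℂ)) × (ZMod N → TorusSite 3 N → Matrix.specialUnitaryGroup (Fin 3) ℂ), ((∏ t : ZMod N, gaugeSliceKernel β (p.1 t) (gaugeTransform (p.2 t)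 (p.1 (t + 1))) : ℝ) : ℂ) * (∑ s : Finset (SliceFermiIdx Nf N), (-1 : ℂ) ^ s.card * (((List.range N).map fun i : ℕ => fermionSliceOp (p.1 (i : ZMod N)) mq * fockGaugeAct (Nf := Nf) (p.2 (i : ZMod N))).prod) s s) * Φ (fun e : Edge 4 N => (Fin.cons (p.2 (e.1 0) (Fin.tail e.1)) (fun i : Fin 3 => p.1 (e.1 0) (Fin.tail e.1, i)) : Fin 4 → Matrix.specialUnitaryGroup (Fin 3) ℂ) e.2) ∂((Measure.pi fun _ : ZMod N => Measure.pi fun _ : Edge 3 N => haarProbability (Matrix.specialUnitaryGroup (Fin 3) ℂ)).prod (Measure.pi fun _ : ZMod N => Measure.pi fun _ : TorusSite 3 N => haarProbability (Matrix.specialUnitaryGroup (Fin 3) ℂ))) := by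
  intro Nf N _ β mq hm Φ hΦ
  -- T1: the assembling map `(Us, gs) ↦ U` is measure preserving (slice Haar ↦ torus Haar)
  obtain ⟨hasm, -⟩ :=
    Summit.QuantumFields.YangMills.Theorems.WeakCouplingHypercubicLimit.TraceNormColdPressure.stub_timeSlicing
      N (Matrix.specialUnitaryGroup (Fin 3) ℂ) (fundamentalRep (Fin 3))
  -- transport the torus integral along the assembling map
  rw [← hasm.map_eq, integral_map hasm.measurable.aemeasurable
    (GluonicExpectation.continuous_integrand_mul Nf N β mq hΦ).aestronglyMeasurable]
  -- and identify the integrands pointwise (the weight `Φ` is read on the assembled field)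
  exact integral_congr_ae (ae_of_all _ fun p =>
    GluonicExpectation.integrand_mul_timeAssemble Nf N β mq hm Φ p)

/-- **Gluonic expectations as cyclic supertrace ratios (stub
`qcdTorusExpect_gaugeObservable_eq_cyclic_ratio` of line `Sketch`).**  For `N_f` flavours of
`r = 1` Wilson quarks of bare masses `m_f > −1` (fundamental representation of `SU(3)`) on the
four-torus `(ℤ/N)⁴` at inverse coupling `β` and every continuous function `Φ` of the gauge field,
the statement's lattice-QCD expectation of the Grassmann-constant insertion `U ↦ Φ(U) · 1` is the
ratio of cyclic transfer-kernel supertrace integrals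
`⟨Φ⟩ = ∫∫ ∏_t K_β · STr ∏_t T̂_F Γ(G) · Φ(asm (Us, gs)) dUs dgs / ∫∫ ∏_t K_β · STr ∏_t T̂_F Γ(G) dUs dgs`
(the Berezin orientation sign and the pure-gauge partition function cancel): unquenched gluonic
expectations are `STr[(𝕋P̂₀)^N Φ] / STr[(𝕋P̂₀)^N]` at kernel level.
[cite: Luscher1977, pp. 283–292] [cite: OsterwalderSeiler1978, §§2–3]
[cite: Smit2023, §4.6 (4.127)–(4.137), §6.5 (6.87)–(6.91)] [cite: MontvayMunster1994, §5.1.2] -/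
theorem qcdTorusExpect_gaugeObservable_eq_cyclic_ratio : ∀ (Nf N : ℕ) [NeZero N] (β : ℝ) (mq : Fin Nf → ℝ), (∀ f, -1 < mq f) → ∀ (Φ : GaugeConfig 4 N (Matrix.specialUnitaryGroup (Fin 3) ℂ) → ℂ), Continuous Φ → qcdTorusExpect β N mq (fun U => algebraMap ℂ (FermiAlg Nf N) (Φ U)) = (∫ p : (ZMod N → GaugeConfig 3 N (Matrix.specialUnitaryGroup (Fin 3) ℂ)) × (ZMod N → TorusSite 3 N → Matrix.specialUnitaryGroup (Fin 3) ℂ), ((∏ t : ZMod N, gaugeSliceKernel β (p.1 t) (gaugeTransform (p.2 t) (p.1 (t + 1))) : ℝ) : ℂ) * (∑ s : Finset (SliceFermiIdx Nf N), (-1 : ℂ) ^ s.card * (((List.range N).map fun i : ℕ => fermionSliceOp (p.1 (i : ZMod N)) mq * fockGaugeAct (Nf := Nf) (p.2 (i : ZMod N))).prod) s s) * Φ (fun e : Edge 4 N => (Fin.cons (p.2 (e.1 0) (Fin.tail e.1)) (fun i : Fin 3 => p.1 (e.1 0) (Fin.tail e.1, i)) : Fin 4 → Matrix.specialUnitaryGroup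 (Fin 3) ℂ) e.2) ∂((Measure.pi fun _ : ZMod N => Measure.pi fun _ : Edge 3 N => haarProbability (Matrix.specialUnitaryGroup (Fin 3) ℂ)).prod (Measure.pi fun _ : ZMod N => Measure.pi fun _ : TorusSite 3 N => haarProbability (Matrix.specialUnitaryGroup (Fin 3) ℂ)))) / (∫ p : (ZMod N → GaugeConfig 3 N (Matrix.specialUnitaryGroup (Fin 3) ℂ)) × (ZMod N → TorusSite 3 N → Matrix.specialUnitaryGroup (Fin 3) ℂ), ((∏ t : ZMod N, gaugeSliceKernel β (p.1 t) (gaugeTransform (p.2 t) (p.1 (t + 1))) : ℝ) : ℂ) * ∑ s : Finset (SliceFermiIdx Nf N), (-1 : ℂ) ^ s.card * (((List.range N).map fun i : ℕ => fermionSliceOp (p.1 (i : ZMod N)) mq * fockGaugeAct (Nf := Nf) (p.2 (i : ZMod N))).prod) s s ∂((Measure.pi fun _ : ZMod N => Measure.pi fun _ : Edge 3 N => haarProbability (Matrix.specialUnitaryGroup (Fin 3) ℂ)).prod (Measure.pi fun _ : ZMod N => Measure.pi fun _ : TorusSite 3 N => haarProbability (Matrix.specialUnitaryGroup (Fin 3)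 ℂ)))) := by
  intro Nf N _ β mq hm Φ hΦ
  unfold qcdTorusExpect
  -- Berezin integrals: `∫dψ̄dψ (Φ · 1) e^{−ψ̄Dψ} = Φ · ε det D`, `∫dψ̄dψ e^{−ψ̄Dψ} = ε det D`
  simp only [GluonicExpectation.fermiIntegral_algebraMap_mul_fermiBoltzmann,
    fermiIntegral_fermiBoltzmann]
  -- Wilson-measure integrals as Haar quotients; cancel `Z_W` and the orientation sign `ε`;
  -- then the two sliced identities
  rw [TorusDenominator.integral_wilsonMeasure_eq_div (continuous_fundamentalRep (Fin 3)) β,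
    TorusDenominator.integral_wilsonMeasure_eq_div (continuous_fundamentalRep (Fin 3)) β,
    div_div_div_cancel_right₀ (GluonicExpectation.ofReal_integral_exp_wilsonAction_ne_zero N β),
    GluonicExpectation.integral_weight_mul_mul_const_mul,
    GluonicExpectation.integral_weight_mul_const_mul,
    mul_div_mul_left _ _ (fermiOrientationSign_ne_zero _),
    qcd_boltzmann_integral_mul_eq_cyclic_supertrace Nf N β mq hm Φ hΦ,
    qcd_boltzmann_integral_eq_cyclic_supertrace_flavour Nf N β mq hm]

end Summit.QuantumFields.QCD.Cruxes.StableActionBridge.Sketch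

end
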